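import Summits.ValiantsHypothesis.ValiantsHypothesis.Theorems.LacunarySymmetroidMatrixDescartesPivotRankOneCriticalWindowsThreeLoneLetter

/-!
# `MatrixDescartes` census — rank-one `(2,4)₁`, lone letter: the END COEFFICIENTS OF THE FOLD QUADRATIC ARE THE `K = 3` LOGARITHMIC DERIVATIVES
# (so two of the three fence statements of the `K = 4` lone-letter programme are instances of `logDeriv_fence`)

HONEST FRAMING.  Object-search cell `pub-symmetroid`, seat `val-sym-mdr-p1` (generation 22); helper file `--supports` the crux item
stmt-ValiantsHypothesis-18050 (`Theses.LacunarySymmetroid.MatrixDescartes`, OPEN, on HOLD) with NO closure claim.  Second kernel piece of the `K = 4`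
lone-letter programme (seat memo LONE-LETTER.md §8b–§8d); companion of `…CriticalWindowsFourCramer` (Cramer frame, minor signs) and of the `K = 3` files
`…CriticalWindowsThree{Fence,Quintic,LoneLetter}`.  No count is proved; nothing bears on `MatrixDescartes` in its window, on `DoorA26` / `DoorA34`, registers
/ credences, or `VP ≠ VNP`.

SETTING (memo §8b).  Pivot `0` at `t₀` (rate `−a`), left letters `i, k` (rates `bᵢ, bₖ`), lone right letter `j` (rate `bⱼ`); minors
`M_{mn} = AₘBₙ − AₙBₘ`; on the right window the Cramer frame is `W₀/Wᵢ = a₁ + b₁ρ`, `Wⱼ/Wᵢ = a₂ + b₂ρ` with `a₁ = M_{ji}/M_{0j}`, `a₂ = M_{i0}/M_{0j}`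
(`b₁, b₂` the same with `k` for `i`), and the Jacobian of `(T,ρ) ↦ (h₁,h₂)` is the FOLD QUADRATIC `C₂ρ² + C₁ρ + C₀` with
`C₀ = γ₀a₁a₂′ − γⱼa₂a₁′`, `γ₀ = (d₀−dᵢ)/(dₖ−dᵢ) = −(a+bᵢ)/(bₖ−bᵢ)`, `γⱼ = (dⱼ−dᵢ)/(dₖ−dᵢ) = (bⱼ−bᵢ)/(bₖ−bᵢ)` (pencil coupling `dₘ − d₀ = a + bₘ`).
THE POINT (def-free; minors, their derivative polynomials and the `K = 3` logarithmic derivative `ℓ` spelled out).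
* §1 `endCoeff_logDeriv_form` — the generic identity `γ₀(P/Q)(R/Q)′ − γⱼ(R/Q)(P/Q)′ = (P/Q)(R/Q)·[γ₀(R′/R − Q′/Q) − γⱼ(P′/P − Q′/Q)]`. [folklore]
* §2 `hasDerivAt_minor_ji / _0j / _i0` — the explicit derivative polynomials of the three minors through `j` and the pivot, and
  `hasDerivAt_ratio` for `a₁ = M_{ji}/M_{0j}`, `a₂ = M_{i0}/M_{0j}` (quotient rule). [folklore]
* §3 `logDeriv_minor_split_*` — `M_{ji} = −X₀`, `M_{0j} = −Xᵢ`, `M_{i0} = −Xⱼ` for the `K = 3` cross product `X` of the TRIPLE `{0, i, j}` (`cross_factor`), hence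
  `M′/M = Q′/Q + 1/(T−t) + 1/(T−t′)` with that triple's brackets. [folklore]
* **§4 `foldEndCoeff_eq_logDeriv` — `(bₖ−bᵢ)·C₀ = −(a+bᵢ)·a₁a₂′ − (bⱼ−bᵢ)·a₂a₁′ = a₁·a₂·ℓ^{(0,i,j)}(T)`**, where `ℓ^{(0,i,j)}` is EXACTLY the logarithmic
  derivative of `…CriticalWindowsThreeQuintic/LoneLetter` for pivot `0`, left letter `i`, right letter `j` (letter `k` does not enter).  The same statement
  with `(bₖ, tₖ)` for `(bᵢ, tᵢ)` is `(bᵢ−bₖ)·C₂ = b₁b₂·ℓ^{(0,k,j)}`.  COROLLARY `foldEndCoeff_oneSignChange`: since `a₁a₂ > 0` on the window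
  (`…FourCramer.minor_signs_right`), `logDeriv_fence` gives ONE sign change of `−(a+bᵢ)a₁a₂′ − (bⱼ−bᵢ)a₂a₁′` on the right window `(Tₘ, tⱼ)` — statements
  (F1a), (F1b) of the memo's `K = 4` programme are theorems; what remains located is the mixed coefficient `C₁` and the monotonicity (F2).
[folklore] Quotient rule, `cross_factor`, the `K = 3` files.  No definitions, no named facts.
-/

-- `Summit.ValiantsHypothesis.ValiantsHypothesis.…` repeats a component by the D-0017 layout
-- (single-conjunct summit), which the `dupNamespace` linter flags; the name is mandated.
set_option linter.dupNamespace false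

namespace Summit.ValiantsHypothesis.ValiantsHypothesis.Theorems.LacunarySymmetroidMatrixDescartes.Pivot.CriticalWindows.Four

open Summit.ValiantsHypothesis.ValiantsHypothesis.Theorems.LacunarySymmetroidMatrixDescartes.Pivot.CriticalWindows.Three

/-! ## 1. The generic identity behind the end coefficients -/

/-- **END COEFFICIENT = PRODUCT × WEIGHTED LOG-DERIVATIVE.**  For `P, Q, R ≠ 0` and any `P′, Q′, R′, γ₀, γⱼ`:
`γ₀·(P/Q)·(R/Q)′ − γⱼ·(R/Q)·(P/Q)′ = (P/Q)(R/Q)·[γ₀(R′/R − Q′/Q) − γⱼ(P′/P − Q′/Q)]` with the quotient-rule values `(P/Q)′ = (P′Q − PQ′)/Q²`,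
`(R/Q)′ = (R′Q − RQ′)/Q²`. [folklore] -/
theorem endCoeff_logDeriv_form (P Q R P' Q' R' γ₀ γj : ℝ) (hP : P ≠ 0) (hQ : Q ≠ 0) (hR : R ≠ 0) :
    γ₀ * (P / Q) * ((R' * Q - R * Q') / Q ^ 2) - γj * (R / Q) * ((P' * Q - P * Q') / Q ^ 2)
      = (P / Q) * (R / Q) * (γ₀ * (R' / R - Q' / Q) - γj * (P' / P - Q' / Q)) := by
  field_simp

/-! ## 2. Derivatives of the three minors through the pivot and the lone letter, and of their ratios -/

/-- **DERIVATIVE OF A MINOR TERM.**  `d/dT [(T² − s²)·β(T − u)²] = 2T·β(T−u)² + (T² − s²)·2β(T−u)`. [folklore] -/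
theorem hasDerivAt_minorTerm (β s u T : ℝ) :
    HasDerivAt (fun T : ℝ => (T ^ 2 - s ^ 2) * (β * (T - u) ^ 2)) (2 * T * (β * (T - u) ^ 2) + (T ^ 2 - s ^ 2) * (2 * β * (T - u))) T := by
  have h1 : HasDerivAt (fun T : ℝ => T ^ 2 - s ^ 2) (2 * T) T := by
    simpa using ((hasDerivAt_pow 2 T).sub_const (s ^ 2))
  have h2 : HasDerivAt (fun T : ℝ => β * (T - u) ^ 2) (2 * β * (T - u)) T := by
    have := (((hasDerivAt_id' T).sub_const u).pow 2).const_mul β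
    refine this.congr_deriv ?_
    simp
    ring
  exact (h1.mul h2).congr_deriv rfl

/-- **DERIVATIVES OF THE MINORS `M_{ji}`, `M_{0j}`, `M_{i0}`.** [folklore] -/
theorem hasDerivAt_minors (a bi bj t₀ ti tj T : ℝ) :
    HasDerivAt (fun T : ℝ => ((T ^ (2:ℕ) - tj ^ (2:ℕ)) * (bi * (T - ti) ^ (2:ℕ)) - (T ^ (2:ℕ) - ti ^ (2:ℕ)) * (bj * (T - tj) ^ (2:ℕ)))) ((2 * T * (bi * (T - ti) ^ (2:ℕ)) + (T ^ (2:ℕ) - tj ^ (2:ℕ)) * (2 * bi * (T - ti))) - (2 * T * (bj * (T - tj) ^ (2:ℕ)) + (T ^ (2:ℕ) - ti ^ (2:ℕ)) * (2 * bj * (T - tj)))) T ∧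
    HasDerivAt (fun T : ℝ => ((T ^ (2:ℕ) - t₀ ^ (2:ℕ)) * (bj * (T - tj) ^ (2:ℕ)) - (T ^ (2:ℕ) - tj ^ (2:ℕ)) * (-a * (T - t₀) ^ (2:ℕ)))) ((2 * T * (bj * (T - tj) ^ (2:ℕ)) + (T ^ (2:ℕ) - t₀ ^ (2:ℕ)) * (2 * bj * (T - tj))) - (2 * T * (-a * (T - t₀) ^ (2:ℕ)) + (T ^ (2:ℕ) - tj ^ (2:ℕ)) * (2 * (-a) * (T - t₀)))) T ∧
    HasDerivAt (fun T : ℝ => ((T ^ (2:ℕ) - ti ^ (2:ℕ)) * (-a * (T - t₀) ^ (2:ℕ)) - (T ^ (2:ℕ) - t₀ ^ (2:ℕ)) * (bi * (T - ti) ^ (2:ℕ)))) ((2 * T * (-a * (T - t₀) ^ (2:ℕ)) + (T ^ (2:ℕ) - ti ^ (2:ℕ)) * (2 * (-a) * (T - t₀))) - (2 * T * (bi * (T - ti) ^ (2:ℕ)) + (T ^ (2:ℕ) - t₀ ^ (2:ℕ)) * (2 * bi * (T - ti)))) T := by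
  refine ⟨?_, ?_, ?_⟩
  · exact ((hasDerivAt_minorTerm bi tj ti T).sub (hasDerivAt_minorTerm bj ti tj T))
  · exact ((hasDerivAt_minorTerm bj t₀ tj T).sub (hasDerivAt_minorTerm (-a) tj t₀ T))
  · exact ((hasDerivAt_minorTerm (-a) ti t₀ T).sub (hasDerivAt_minorTerm bi t₀ ti T))

/-- **DERIVATIVES OF THE RATIOS `a₁ = M_{ji}/M_{0j}`, `a₂ = M_{i0}/M_{0j}`** (quotient rule; `M_{0j}(T) ≠ 0`). [folklore] -/
theorem hasDerivAt_ratios {a bi bj t₀ ti tj T : ℝ} (hQ : ((T ^ (2:ℕ) - t₀ ^ (2:ℕ)) * (bj * (T - tj) ^ (2:ℕ)) - (T ^ (2:ℕ) - tj ^ (2:ℕ)) * (-a * (T - t₀) ^ (2:ℕ))) ≠ 0) :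
    HasDerivAt (fun T : ℝ => ((T ^ (2:ℕ) - tj ^ (2:ℕ)) * (bi * (T - ti) ^ (2:ℕ)) - (T ^ (2:ℕ) - ti ^ (2:ℕ)) * (bj * (T - tj) ^ (2:ℕ))) / ((T ^ (2:ℕ) - t₀ ^ (2:ℕ)) * (bj * (T - tj) ^ (2:ℕ)) - (T ^ (2:ℕ) - tj ^ (2:ℕ)) * (-a * (T - t₀) ^ (2:ℕ))))
      ((((2 * T * (bi * (T - ti) ^ (2:ℕ)) + (T ^ (2:ℕ) - tj ^ (2:ℕ)) * (2 * bi * (T - ti))) - (2 * T * (bj * (T - tj) ^ (2:ℕ)) + (T ^ (2:ℕ) - ti ^ (2:ℕ)) * (2 * bj * (T - tj)))) * ((T ^ (2:ℕ) - t₀ ^ (2:ℕ)) * (bj * (T - tj) ^ (2:ℕ)) - (T ^ (2:ℕ) - tj ^ (2:ℕ)) * (-a * (T - t₀) ^ (2:ℕ))) - ((T ^ (2:ℕ) - tj ^ (2:ℕ)) * (bi * (T - ti) ^ (2:ℕ)) - (T ^ (2:ℕ) - ti ^ (2:ℕ)) * (bj * (T - tj) ^ (2:ℕ))) * ((2 *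 T * (bj * (T - tj) ^ (2:ℕ)) + (T ^ (2:ℕ) - t₀ ^ (2:ℕ)) * (2 * bj * (T - tj))) - (2 * T * (-a * (T - t₀) ^ (2:ℕ)) + (T ^ (2:ℕ) - tj ^ (2:ℕ)) * (2 * (-a) * (T - t₀))))) / ((T ^ (2:ℕ) - t₀ ^ (2:ℕ)) * (bj * (T - tj) ^ (2:ℕ)) - (T ^ (2:ℕ) - tj ^ (2:ℕ)) * (-a * (T - t₀) ^ (2:ℕ))) ^ 2) T ∧
    HasDerivAt (fun T : ℝ => ((T ^ (2:ℕ) - ti ^ (2:ℕ)) * (-a * (T - t₀) ^ (2:ℕ)) - (T ^ (2:ℕ) - t₀ ^ (2:ℕ)) * (bi * (T - ti) ^ (2:ℕ))) / ((T ^ (2:ℕ) - t₀ ^ (2:ℕ)) * (bj * (T - tj) ^ (2:ℕ)) - (T ^ (2:ℕ) - tj ^ (2:ℕ)) * (-a * (T - t₀) ^ (2:ℕ))))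
      ((((2 * T * (-a * (T - t₀) ^ (2:ℕ)) + (T ^ (2:ℕ) - ti ^ (2:ℕ)) * (2 * (-a) * (T - t₀))) - (2 * T * (bi * (T - ti) ^ (2:ℕ)) + (T ^ (2:ℕ) - t₀ ^ (2:ℕ)) * (2 * bi * (T - ti)))) * ((T ^ (2:ℕ) - t₀ ^ (2:ℕ)) * (bj * (T - tj) ^ (2:ℕ)) - (T ^ (2:ℕ) - tj ^ (2:ℕ)) * (-a * (T - t₀) ^ (2:ℕ))) - ((T ^ (2:ℕ) - ti ^ (2:ℕ)) * (-a * (T - t₀) ^ (2:ℕ)) - (T ^ (2:ℕ) - t₀ ^ (2:ℕ)) * (bi * (T - ti) ^ (2:ℕ))) * ((2 * T * (bj * (T - tj) ^ (2:ℕ)) + (T ^ (2:ℕ) - t₀ ^ (2:ℕ)) * (2 * bj * (T - tj))) - (2 * T * (-a * (T - t₀) ^ (2:ℕ)) + (T ^ (2:ℕ) - tj ^ (2:ℕ)) * (2 * (-a) * (T - t₀))))) / ((T ^ (2:ℕ) - t₀ ^ (2:ℕ)) * (bj * (T - tj) ^ (2:ℕ)) - (T ^ (2:ℕ) - tj ^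 (2:ℕ)) * (-a * (T - t₀) ^ (2:ℕ))) ^ 2) T := by
  obtain ⟨hji, h0j, hi0⟩ := hasDerivAt_minors a bi bj t₀ ti tj T
  exact ⟨hji.div h0j hQ, hi0.div h0j hQ⟩

/-! ## 3. The minors through `j` and the pivot are the `K = 3` cross product of the triple `{0, i, j}` -/

/-- **`M_{ji} = −X₀`, `M_{0j} = −Xᵢ`, `M_{i0} = −Xⱼ`** for the factored cross product of `…CriticalWindowsThree.cross_factor`, and the corresponding derivative
polynomials split as `M′ = −[(T−t′)Q + (T−t)Q + (T−t)(T−t′)Q′]`. [folklore] -/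
theorem minors_eq_neg_cross (a bi bj t₀ ti tj T : ℝ) :
    ((T ^ (2:ℕ) - tj ^ (2:ℕ)) * (bi * (T - ti) ^ (2:ℕ)) - (T ^ (2:ℕ) - ti ^ (2:ℕ)) * (bj * (T - tj) ^ (2:ℕ))) = -((T - ti) * (T - tj) * (bj * (T + ti) * (T - tj) - bi * (T + tj) * (T - ti))) ∧
    ((T ^ (2:ℕ) - t₀ ^ (2:ℕ)) * (bj * (T - tj) ^ (2:ℕ)) - (T ^ (2:ℕ) - tj ^ (2:ℕ)) * (-a * (T - t₀) ^ (2:ℕ))) = -((T - tj) * (T - t₀) * (bj * (T + t₀) * (tj - T) - a * (T + tj) * (T - t₀))) ∧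
    ((T ^ (2:ℕ) - ti ^ (2:ℕ)) * (-a * (T - t₀) ^ (2:ℕ)) - (T ^ (2:ℕ) - t₀ ^ (2:ℕ)) * (bi * (T - ti) ^ (2:ℕ))) = -((T - t₀) * (T - ti) * (bi * (T + t₀) * (T - ti) + a * (T + ti) * (T - t₀))) ∧
    ((2 * T * (bi * (T - ti) ^ (2:ℕ)) + (T ^ (2:ℕ) - tj ^ (2:ℕ)) * (2 * bi * (T - ti))) - (2 * T * (bj * (T - tj) ^ (2:ℕ)) + (T ^ (2:ℕ) - ti ^ (2:ℕ)) * (2 * bj * (T - tj)))) = -((T - tj) * (bj * (T + ti) * (T - tj) - bi * (T + tj) * (T - ti)) + (T - ti) * (bj * (T + ti) * (T - tj) - bi * (T + tj) * (T - ti)) + (T - ti) * (T - tj) * (bj * ((T - tj) + (T + ti)) - bi * ((T - ti) + (T + tj)))) ∧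
    ((2 * T * (bj * (T - tj) ^ (2:ℕ)) + (T ^ (2:ℕ) - t₀ ^ (2:ℕ)) * (2 * bj * (T - tj))) - (2 * T * (-a * (T - t₀) ^ (2:ℕ)) + (T ^ (2:ℕ) - tj ^ (2:ℕ)) * (2 * (-a) * (T - t₀)))) = -((T - t₀) * (bj * (T + t₀) * (tj - T) - a * (T + tj) * (T - t₀)) + (T - tj) * (bj * (T + t₀) * (tj - T) - a * (T + tj) * (T - t₀)) + (T - tj) * (T - t₀) * (bj * ((tj - T) - (T + t₀)) - a * ((T - t₀) + (T + tj)))) ∧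
    ((2 * T * (-a * (T - t₀) ^ (2:ℕ)) + (T ^ (2:ℕ) - ti ^ (2:ℕ)) * (2 * (-a) * (T - t₀))) - (2 * T * (bi * (T - ti) ^ (2:ℕ)) + (T ^ (2:ℕ) - t₀ ^ (2:ℕ)) * (2 * bi * (T - ti)))) = -((T - ti) * (bi * (T + t₀) * (T - ti) + a * (T + ti) * (T - t₀)) + (T - t₀) * (bi * (T + t₀) * (T - ti) + a * (T + ti) * (T - t₀)) + (T - t₀) * (T - ti) * (bi * ((T - ti) + (T + t₀)) + a * ((T - t₀) + (T + ti)))) := by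
  refine ⟨by ring, by ring, by ring, by ring, by ring, by ring⟩

/-- **LOG-DERIVATIVE SPLIT.**  If `M = −(T−t)(T−t′)Q` and `M′ = −[(T−t′)Q + (T−t)Q + (T−t)(T−t′)Q′]` with `Q, T−t, T−t′ ≠ 0` then
`M′/M = Q′/Q + 1/(T−t) + 1/(T−t′)`. [folklore] -/
theorem logDeriv_split {M M' Q Q' T t t' : ℝ} (hQ : Q ≠ 0) (ht : T - t ≠ 0) (ht' : T - t' ≠ 0)
    (hM : M = -((T - t) * (T - t') * Q)) (hM' : M' = -((T - t') * Q + (T - t) * Q + (T - t) * (T - t') * Q')) :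
    M' / M = Q' / Q + 1 / (T - t) + 1 / (T - t') := by
  have hMne : M ≠ 0 := by rw [hM]; exact neg_ne_zero.mpr (mul_ne_zero (mul_ne_zero ht ht') hQ)
  rw [div_add_div _ _ hQ ht, div_add_div _ _ (mul_ne_zero hQ ht) ht', div_eq_div_iff hMne (mul_ne_zero (mul_ne_zero hQ ht) ht')]
  rw [hM, hM']
  ring

/-! ## 4. The end coefficient of the fold quadratic is `a₁a₂ · ℓ^{(0,i,j)}` -/

/-- **THE END COEFFICIENT IS THE `K = 3` LOGARITHMIC DERIVATIVE.**  On the right window (all brackets and linear factors nonzero), with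
`a₁ = M_{ji}/M_{0j}`, `a₂ = M_{i0}/M_{0j}` and their derivatives `a₁′, a₂′` (`hasDerivAt_ratios`):
`−(a+bᵢ)·a₁·a₂′ − (bⱼ−bᵢ)·a₂·a₁′ = a₁·a₂·ℓ^{(0,i,j)}(T)` — i.e. `(bₖ−bᵢ)·C₀ = a₁a₂·ℓ^{(0,i,j)}` for the fold quadratic's constant coefficient
`C₀ = γ₀a₁a₂′ − γⱼa₂a₁′`, `γ₀ = −(a+bᵢ)/(bₖ−bᵢ)`, `γⱼ = (bⱼ−bᵢ)/(bₖ−bᵢ)`; the fourth letter `k` does not enter, and the same theorem with `(bₖ,tₖ)` in place of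
`(bᵢ,tᵢ)` gives `(bᵢ−bₖ)·C₂ = b₁b₂·ℓ^{(0,k,j)}`. [folklore] -/
theorem foldEndCoeff_eq_logDeriv {a bi bj t₀ ti tj T : ℝ} (h0 : (bj * (T + ti) * (T - tj) - bi * (T + tj) * (T - ti)) ≠ 0) (hi : (bj * (T + t₀) * (tj - T) - a * (T + tj) * (T - t₀)) ≠ 0) (hj : (bi * (T + t₀) * (T - ti) + a * (T + ti) * (T - t₀)) ≠ 0)
    (l0 : T - t₀ ≠ 0) (li : T - ti ≠ 0) (lj : T - tj ≠ 0) :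
    -(a + bi) * (((T ^ (2:ℕ) - tj ^ (2:ℕ)) * (bi * (T - ti) ^ (2:ℕ)) - (T ^ (2:ℕ) - ti ^ (2:ℕ)) * (bj * (T - tj) ^ (2:ℕ))) / ((T ^ (2:ℕ) - t₀ ^ (2:ℕ)) * (bj * (T - tj) ^ (2:ℕ)) - (T ^ (2:ℕ) - tj ^ (2:ℕ)) * (-a * (T - t₀) ^ (2:ℕ))))
        * ((((2 * T * (-a * (T - t₀) ^ (2:ℕ)) + (T ^ (2:ℕ) - ti ^ (2:ℕ)) * (2 * (-a) * (T - t₀))) - (2 * T * (bi * (T - ti) ^ (2:ℕ)) + (T ^ (2:ℕ) - t₀ ^ (2:ℕ)) * (2 * bi * (T - ti)))) * ((T ^ (2:ℕ) - t₀ ^ (2:ℕ)) * (bj * (T - tj) ^ (2:ℕ)) - (T ^ (2:ℕ) - tj ^ (2:ℕ)) * (-a * (T - t₀) ^ (2:ℕ))) - ((T ^ (2:ℕ) - ti ^ (2:ℕ)) * (-a * (T - t₀) ^ (2:ℕ)) - (T ^ (2:ℕ) - t₀ ^ (2:ℕ)) * (bi * (T - ti) ^ (2:ℕ))) * ((2 *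 T * (bj * (T - tj) ^ (2:ℕ)) + (T ^ (2:ℕ) - t₀ ^ (2:ℕ)) * (2 * bj * (T - tj))) - (2 * T * (-a * (T - t₀) ^ (2:ℕ)) + (T ^ (2:ℕ) - tj ^ (2:ℕ)) * (2 * (-a) * (T - t₀))))) / ((T ^ (2:ℕ) - t₀ ^ (2:ℕ)) * (bj * (T - tj) ^ (2:ℕ)) - (T ^ (2:ℕ) - tj ^ (2:ℕ)) * (-a * (T - t₀) ^ (2:ℕ))) ^ 2)
      - (bj - bi) * (((T ^ (2:ℕ) - ti ^ (2:ℕ)) * (-a * (T - t₀) ^ (2:ℕ)) - (T ^ (2:ℕ) - t₀ ^ (2:ℕ)) * (bi * (T - ti) ^ (2:ℕ))) / ((T ^ (2:ℕ) - t₀ ^ (2:ℕ)) * (bj * (T - tj) ^ (2:ℕ)) - (T ^ (2:ℕ) - tj ^ (2:ℕ)) * (-a * (T - t₀) ^ (2:ℕ))))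
        * ((((2 * T * (bi * (T - ti) ^ (2:ℕ)) + (T ^ (2:ℕ) - tj ^ (2:ℕ)) * (2 * bi * (T - ti))) - (2 * T * (bj * (T - tj) ^ (2:ℕ)) + (T ^ (2:ℕ) - ti ^ (2:ℕ)) * (2 * bj * (T - tj)))) * ((T ^ (2:ℕ) - t₀ ^ (2:ℕ)) * (bj * (T - tj) ^ (2:ℕ)) - (T ^ (2:ℕ) - tj ^ (2:ℕ)) * (-a * (T - t₀) ^ (2:ℕ))) - ((T ^ (2:ℕ) - tj ^ (2:ℕ)) * (bi * (T - ti) ^ (2:ℕ)) - (T ^ (2:ℕ) - ti ^ (2:ℕ)) * (bj * (T - tj) ^ (2:ℕ))) * ((2 * T * (bj * (T - tj) ^ (2:ℕ)) + (T ^ (2:ℕ) - t₀ ^ (2:ℕ)) * (2 * bj * (T - tj))) - (2 * T * (-a * (T - t₀) ^ (2:ℕ)) + (T ^ (2:ℕ) - tj ^ (2:ℕ)) * (2 * (-a) * (T - t₀))))) / ((T ^ (2:ℕ) - t₀ ^ (2:ℕ)) * (bj * (T - tj) ^ (2:ℕ)) - (T ^ (2:ℕ) - tj ^ (2:ℕ))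 * (-a * (T - t₀) ^ (2:ℕ))) ^ 2)
    = (((T ^ (2:ℕ) - tj ^ (2:ℕ)) * (bi * (T - ti) ^ (2:ℕ)) - (T ^ (2:ℕ) - ti ^ (2:ℕ)) * (bj * (T - tj) ^ (2:ℕ))) / ((T ^ (2:ℕ) - t₀ ^ (2:ℕ)) * (bj * (T - tj) ^ (2:ℕ)) - (T ^ (2:ℕ) - tj ^ (2:ℕ)) * (-a * (T - t₀) ^ (2:ℕ)))) * (((T ^ (2:ℕ) - ti ^ (2:ℕ)) * (-a * (T - t₀) ^ (2:ℕ)) - (T ^ (2:ℕ) - t₀ ^ (2:ℕ)) * (bi * (T - ti) ^ (2:ℕ))) / ((T ^ (2:ℕ) - t₀ ^ (2:ℕ)) * (bj * (T - tj) ^ (2:ℕ)) - (T ^ (2:ℕ) - tj ^ (2:ℕ)) * (-a * (T - t₀) ^ (2:ℕ))))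
      * ((bi - bj) * ((bj * ((T - tj) + (T + ti)) - bi * ((T - ti) + (T + tj))) / (bj * (T + ti) * (T - tj) - bi * (T + tj) * (T - ti)) - 1 / (T - t₀))
      + (a + bj) * ((bj * ((tj - T) - (T + t₀)) - a * ((T - t₀) + (T + tj))) / (bj * (T + t₀) * (tj - T) - a * (T + tj) * (T - t₀)) - 1 / (T - ti))
      - (a + bi) * ((bi * ((T - ti) + (T + t₀)) + a * ((T - t₀) + (T + ti))) / (bi * (T + t₀) * (T - ti) + a * (T + ti) * (T - t₀)) - 1 / (T - tj))) := by
  obtain ⟨eji, e0j, ei0, dji, d0j, di0⟩ := minors_eq_neg_cross a bi bj t₀ ti tj T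
  have hP : ((T ^ (2:ℕ) - tj ^ (2:ℕ)) * (bi * (T - ti) ^ (2:ℕ)) - (T ^ (2:ℕ) - ti ^ (2:ℕ)) * (bj * (T - tj) ^ (2:ℕ))) ≠ 0 := by rw [eji]; exact neg_ne_zero.mpr (mul_ne_zero (mul_ne_zero li lj) h0)
  have hQ : ((T ^ (2:ℕ) - t₀ ^ (2:ℕ)) * (bj * (T - tj) ^ (2:ℕ)) - (T ^ (2:ℕ) - tj ^ (2:ℕ)) * (-a * (T - t₀) ^ (2:ℕ))) ≠ 0 := by rw [e0j]; exact neg_ne_zero.mpr (mul_ne_zero (mul_ne_zero lj l0) hi)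
  have hR : ((T ^ (2:ℕ) - ti ^ (2:ℕ)) * (-a * (T - t₀) ^ (2:ℕ)) - (T ^ (2:ℕ) - t₀ ^ (2:ℕ)) * (bi * (T - ti) ^ (2:ℕ))) ≠ 0 := by rw [ei0]; exact neg_ne_zero.mpr (mul_ne_zero (mul_ne_zero l0 li) hj)
  rw [endCoeff_logDeriv_form _ _ _ _ _ _ (-(a + bi)) (bj - bi) hP hQ hR]
  have s0 := logDeriv_split h0 li lj eji dji
  have si := logDeriv_split hi lj l0 e0j d0j
  have sj := logDeriv_split hj l0 li ei0 di0
  rw [s0, si, sj]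
  ring

/-- **COROLLARY (F1 of the `K = 4` programme, end coefficients): ONE SIGN CHANGE ON THE WINDOW.**  For `0 < tᵢ < t₀ < tⱼ`, positive rates: there are
`Tₘ < T_R < tⱼ` (`Tₘ` the window edge) such that the end-coefficient combination `−(a+bᵢ)a₁a₂′ − (bⱼ−bᵢ)a₂a₁′` is `> 0` on `(Tₘ, T_R)`, `= 0` at `T_R` and
`< 0` on `(T_R, tⱼ)` — because it equals `a₁a₂·ℓ^{(0,i,j)}` with `a₁a₂ > 0` there, and `ℓ^{(0,i,j)}` has exactly this sign pattern (`logDeriv_fence`).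
[folklore] -/
theorem foldEndCoeff_oneSignChange {a bi bj t₀ ti tj : ℝ} (ha : 0 < a) (hbi : 0 < bi) (hbj : 0 < bj) (hti : 0 < ti) (hi0 : ti < t₀)
    (h0j : t₀ < tj) :
    ∃ Tm TR : ℝ, t₀ < Tm ∧ Tm < TR ∧ TR < tj ∧ (bj * (Tm + t₀) * (tj - Tm) - a * (Tm + tj) * (Tm - t₀)) = 0 ∧
      (∀ T : ℝ, Tm < T → (bj * (T + t₀) * (tj - T) - a * (T + tj) * (T - t₀)) < 0) ∧
      (∀ T : ℝ, Tm < T → T < TR →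
        0 < -(a + bi) * (((T ^ (2:ℕ) - tj ^ (2:ℕ)) * (bi * (T - ti) ^ (2:ℕ)) - (T ^ (2:ℕ) - ti ^ (2:ℕ)) * (bj * (T - tj) ^ (2:ℕ))) / ((T ^ (2:ℕ) - t₀ ^ (2:ℕ)) * (bj * (T - tj) ^ (2:ℕ)) - (T ^ (2:ℕ) - tj ^ (2:ℕ)) * (-a * (T - t₀) ^ (2:ℕ))))
            * ((((2 * T * (-a * (T - t₀) ^ (2:ℕ)) + (T ^ (2:ℕ) - ti ^ (2:ℕ)) * (2 * (-a) * (T - t₀))) - (2 * T * (bi * (T - ti) ^ (2:ℕ)) + (T ^ (2:ℕ) - t₀ ^ (2:ℕ)) * (2 * bi * (T - ti)))) * ((T ^ (2:ℕ) - t₀ ^ (2:ℕ)) * (bj * (T - tj) ^ (2:ℕ)) - (T ^ (2:ℕ) - tj ^ (2:ℕ)) * (-a * (T - t₀) ^ (2:ℕ))) - ((T ^ (2:ℕ) - ti ^ (2:ℕ)) * (-a * (T - t₀) ^ (2:ℕ)) - (T ^ (2:ℕ) - t₀ ^ (2:ℕ)) * (bi * (T - ti) ^ (2:ℕ))) * ((2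 * T * (bj * (T - tj) ^ (2:ℕ)) + (T ^ (2:ℕ) - t₀ ^ (2:ℕ)) * (2 * bj * (T - tj))) - (2 * T * (-a * (T - t₀) ^ (2:ℕ)) + (T ^ (2:ℕ) - tj ^ (2:ℕ)) * (2 * (-a) * (T - t₀))))) / ((T ^ (2:ℕ) - t₀ ^ (2:ℕ)) * (bj * (T - tj) ^ (2:ℕ)) - (T ^ (2:ℕ) - tj ^ (2:ℕ)) * (-a * (T - t₀) ^ (2:ℕ))) ^ 2)
          - (bj - bi) * (((T ^ (2:ℕ) - ti ^ (2:ℕ)) * (-a * (T - t₀) ^ (2:ℕ)) - (T ^ (2:ℕ) - t₀ ^ (2:ℕ)) * (bi * (T - ti) ^ (2:ℕ))) / ((T ^ (2:ℕ) - t₀ ^ (2:ℕ)) * (bj * (T - tj) ^ (2:ℕ)) - (T ^ (2:ℕ) - tj ^ (2:ℕ)) * (-a * (T - t₀) ^ (2:ℕ))))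
            * ((((2 * T * (bi * (T - ti) ^ (2:ℕ)) + (T ^ (2:ℕ) - tj ^ (2:ℕ)) * (2 * bi * (T - ti))) - (2 * T * (bj * (T - tj) ^ (2:ℕ)) + (T ^ (2:ℕ) - ti ^ (2:ℕ)) * (2 * bj * (T - tj)))) * ((T ^ (2:ℕ) - t₀ ^ (2:ℕ)) * (bj * (T - tj) ^ (2:ℕ)) - (T ^ (2:ℕ) - tj ^ (2:ℕ)) * (-a * (T - t₀) ^ (2:ℕ))) - ((T ^ (2:ℕ) - tj ^ (2:ℕ)) * (bi * (T - ti) ^ (2:ℕ)) - (T ^ (2:ℕ) - ti ^ (2:ℕ)) * (bj * (T - tj) ^ (2:ℕ))) * ((2 * T * (bj * (T - tj) ^ (2:ℕ)) + (T ^ (2:ℕ) - t₀ ^ (2:ℕ)) * (2 * bj * (T - tj))) - (2 * T * (-a * (T - t₀) ^ (2:ℕ)) + (T ^ (2:ℕ) - tj ^ (2:ℕ)) * (2 * (-a) * (T - t₀))))) / ((T ^ (2:ℕ) - t₀ ^ (2:ℕ)) * (bj * (T - tj) ^ (2:ℕ)) - (T ^ (2:ℕ) - tj ^ (2:ℕ))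 * (-a * (T - t₀) ^ (2:ℕ))) ^ 2)) ∧
      (-(a + bi) * (((TR ^ (2:ℕ) - tj ^ (2:ℕ)) * (bi * (TR - ti) ^ (2:ℕ)) - (TR ^ (2:ℕ) - ti ^ (2:ℕ)) * (bj * (TR - tj) ^ (2:ℕ))) / ((TR ^ (2:ℕ) - t₀ ^ (2:ℕ)) * (bj * (TR - tj) ^ (2:ℕ)) - (TR ^ (2:ℕ) - tj ^ (2:ℕ)) * (-a * (TR - t₀) ^ (2:ℕ))))
            * ((((2 * TR * (-a * (TR - t₀) ^ (2:ℕ)) + (TR ^ (2:ℕ) - ti ^ (2:ℕ)) * (2 * (-a) * (TR - t₀))) - (2 * TR * (bi * (TR - ti) ^ (2:ℕ)) + (TR ^ (2:ℕ) - t₀ ^ (2:ℕ)) * (2 * bi * (TR - ti)))) * ((TR ^ (2:ℕ) - t₀ ^ (2:ℕ)) * (bj * (TR - tj) ^ (2:ℕ)) - (TR ^ (2:ℕ) - tj ^ (2:ℕ)) * (-a * (TR - t₀) ^ (2:ℕ))) - ((TR ^ (2:ℕ) - ti ^ (2:ℕ)) * (-a * (TR - t₀) ^ (2:ℕ)) -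 (TR ^ (2:ℕ) - t₀ ^ (2:ℕ)) * (bi * (TR - ti) ^ (2:ℕ))) * ((2 * TR * (bj * (TR - tj) ^ (2:ℕ)) + (TR ^ (2:ℕ) - t₀ ^ (2:ℕ)) * (2 * bj * (TR - tj))) - (2 * TR * (-a * (TR - t₀) ^ (2:ℕ)) + (TR ^ (2:ℕ) - tj ^ (2:ℕ)) * (2 * (-a) * (TR - t₀))))) / ((TR ^ (2:ℕ) - t₀ ^ (2:ℕ)) * (bj * (TR - tj) ^ (2:ℕ)) - (TR ^ (2:ℕ) - tj ^ (2:ℕ)) * (-a * (TR - t₀) ^ (2:ℕ))) ^ 2)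
          - (bj - bi) * (((TR ^ (2:ℕ) - ti ^ (2:ℕ)) * (-a * (TR - t₀) ^ (2:ℕ)) - (TR ^ (2:ℕ) - t₀ ^ (2:ℕ)) * (bi * (TR - ti) ^ (2:ℕ))) / ((TR ^ (2:ℕ) - t₀ ^ (2:ℕ)) * (bj * (TR - tj) ^ (2:ℕ)) - (TR ^ (2:ℕ) - tj ^ (2:ℕ)) * (-a * (TR - t₀) ^ (2:ℕ))))
            * ((((2 * TR * (bi * (TR - ti) ^ (2:ℕ)) + (TR ^ (2:ℕ) - tj ^ (2:ℕ)) * (2 * bi * (TR - ti))) - (2 * TR * (bj * (TR - tj) ^ (2:ℕ)) + (TR ^ (2:ℕ) - ti ^ (2:ℕ)) * (2 * bj * (TR - tj)))) * ((TR ^ (2:ℕ) - t₀ ^ (2:ℕ)) * (bj * (TR - tj) ^ (2:ℕ)) - (TR ^ (2:ℕ) - tj ^ (2:ℕ)) * (-a * (TR - t₀) ^ (2:ℕ))) - ((TR ^ (2:ℕ) - tj ^ (2:ℕ)) * (bi * (TR - ti) ^ (2:ℕ)) - (TR ^ (2:ℕ) - ti ^ (2:ℕ)) * (bj * (TR - tj)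 ^ (2:ℕ))) * ((2 * TR * (bj * (TR - tj) ^ (2:ℕ)) + (TR ^ (2:ℕ) - t₀ ^ (2:ℕ)) * (2 * bj * (TR - tj))) - (2 * TR * (-a * (TR - t₀) ^ (2:ℕ)) + (TR ^ (2:ℕ) - tj ^ (2:ℕ)) * (2 * (-a) * (TR - t₀))))) / ((TR ^ (2:ℕ) - t₀ ^ (2:ℕ)) * (bj * (TR - tj) ^ (2:ℕ)) - (TR ^ (2:ℕ) - tj ^ (2:ℕ)) * (-a * (TR - t₀) ^ (2:ℕ))) ^ 2) = 0) ∧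
      (∀ T : ℝ, TR < T → T < tj →
        -(a + bi) * (((T ^ (2:ℕ) - tj ^ (2:ℕ)) * (bi * (T - ti) ^ (2:ℕ)) - (T ^ (2:ℕ) - ti ^ (2:ℕ)) * (bj * (T - tj) ^ (2:ℕ))) / ((T ^ (2:ℕ) - t₀ ^ (2:ℕ)) * (bj * (T - tj) ^ (2:ℕ)) - (T ^ (2:ℕ) - tj ^ (2:ℕ)) * (-a * (T - t₀) ^ (2:ℕ))))
            * ((((2 * T * (-a * (T - t₀) ^ (2:ℕ)) + (T ^ (2:ℕ) - ti ^ (2:ℕ)) * (2 * (-a) * (T - t₀))) - (2 * T * (bi * (T - ti) ^ (2:ℕ)) + (T ^ (2:ℕ) - t₀ ^ (2:ℕ)) * (2 * bi * (T - ti)))) * ((T ^ (2:ℕ) - t₀ ^ (2:ℕ)) * (bj * (T - tj) ^ (2:ℕ)) - (T ^ (2:ℕ) - tj ^ (2:ℕ)) * (-a * (T - t₀) ^ (2:ℕ))) - ((T ^ (2:ℕ) - ti ^ (2:ℕ)) * (-a * (T - t₀) ^ (2:ℕ)) - (T ^ (2:ℕ) - t₀ ^ (2:ℕ)) * (bi *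 (T - ti) ^ (2:ℕ))) * ((2 * T * (bj * (T - tj) ^ (2:ℕ)) + (T ^ (2:ℕ) - t₀ ^ (2:ℕ)) * (2 * bj * (T - tj))) - (2 * T * (-a * (T - t₀) ^ (2:ℕ)) + (T ^ (2:ℕ) - tj ^ (2:ℕ)) * (2 * (-a) * (T - t₀))))) / ((T ^ (2:ℕ) - t₀ ^ (2:ℕ)) * (bj * (T - tj) ^ (2:ℕ)) - (T ^ (2:ℕ) - tj ^ (2:ℕ)) * (-a * (T - t₀) ^ (2:ℕ))) ^ 2)
          - (bj - bi) * (((T ^ (2:ℕ) - ti ^ (2:ℕ)) * (-a * (T - t₀) ^ (2:ℕ)) - (T ^ (2:ℕ) - t₀ ^ (2:ℕ)) * (bi * (T - ti) ^ (2:ℕ))) / ((T ^ (2:ℕ) - t₀ ^ (2:ℕ)) * (bj * (T - tj) ^ (2:ℕ)) - (T ^ (2:ℕ) - tj ^ (2:ℕ)) * (-a * (T - t₀) ^ (2:ℕ))))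
            * ((((2 * T * (bi * (T - ti) ^ (2:ℕ)) + (T ^ (2:ℕ) - tj ^ (2:ℕ)) * (2 * bi * (T - ti))) - (2 * T * (bj * (T - tj) ^ (2:ℕ)) + (T ^ (2:ℕ) - ti ^ (2:ℕ)) * (2 * bj * (T - tj)))) * ((T ^ (2:ℕ) - t₀ ^ (2:ℕ)) * (bj * (T - tj) ^ (2:ℕ)) - (T ^ (2:ℕ) - tj ^ (2:ℕ)) * (-a * (T - t₀) ^ (2:ℕ))) - ((T ^ (2:ℕ) - tj ^ (2:ℕ)) * (bi * (T - ti) ^ (2:ℕ)) - (T ^ (2:ℕ) - ti ^ (2:ℕ)) * (bj * (T - tj) ^ (2:ℕ))) * ((2 * T * (bj * (T - tj) ^ (2:ℕ)) + (T ^ (2:ℕ) - t₀ ^ (2:ℕ)) * (2 * bj * (T - tj))) - (2 * T * (-a * (T - t₀) ^ (2:ℕ)) + (T ^ (2:ℕ) - tj ^ (2:ℕ)) * (2 * (-a) * (T - t₀))))) / ((T ^ (2:ℕ) - t₀ ^ (2:ℕ)) * (bj * (T - tj) ^ (2:ℕ)) - (T ^ (2:ℕ) - tj ^ (2:ℕ))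 * (-a * (T - t₀) ^ (2:ℕ))) ^ 2) < 0) := by
  obtain ⟨Tm, rp, TL, TR, ⟨hL1, hL2, hrp2, hTm1, hR1, hR2⟩, hTm0, hrp0, qi_pos, qi_neg, qj_neg, qj_pos,
    ellR_pos, ellR_zero, ellR_neg, -, -, -⟩ := logDeriv_fence ha hbi hbj hti hi0 h0j
  obtain ⟨q0neg, -, -, -, -, -⟩ := bracket_signs ha hbi hbj hti hi0 h0j
  -- on the right window: brackets nonzero and `a₁ a₂ > 0`
  have frame : ∀ T : ℝ, Tm < T → T < tj →
      (-(a + bi) * (((T ^ (2:ℕ) - tj ^ (2:ℕ)) * (bi * (T - ti) ^ (2:ℕ)) - (T ^ (2:ℕ) - ti ^ (2:ℕ)) * (bj * (T - tj) ^ (2:ℕ))) / ((T ^ (2:ℕ) - t₀ ^ (2:ℕ)) * (bj * (T - tj) ^ (2:ℕ)) - (T ^ (2:ℕ) - tj ^ (2:ℕ)) * (-a * (T - t₀) ^ (2:ℕ))))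
            * ((((2 * T * (-a * (T - t₀) ^ (2:ℕ)) + (T ^ (2:ℕ) - ti ^ (2:ℕ)) * (2 * (-a) * (T - t₀))) - (2 * T * (bi * (T - ti) ^ (2:ℕ)) + (T ^ (2:ℕ) - t₀ ^ (2:ℕ)) * (2 * bi * (T - ti)))) * ((T ^ (2:ℕ) - t₀ ^ (2:ℕ)) * (bj * (T - tj) ^ (2:ℕ)) - (T ^ (2:ℕ) - tj ^ (2:ℕ)) * (-a * (T - t₀) ^ (2:ℕ))) - ((T ^ (2:ℕ) - ti ^ (2:ℕ)) * (-a * (T - t₀) ^ (2:ℕ)) - (T ^ (2:ℕ) - t₀ ^ (2:ℕ)) * (bi * (T - ti) ^ (2:ℕ))) * ((2 * T * (bj * (T - tj) ^ (2:ℕ)) + (T ^ (2:ℕ) - t₀ ^ (2:ℕ)) * (2 * bj * (T - tj))) - (2 * T * (-a * (T - t₀) ^ (2:ℕ)) + (T ^ (2:ℕ) - tj ^ (2:ℕ)) * (2 * (-a) * (T - t₀))))) / ((T ^ (2:ℕ) - t₀ ^ (2:ℕ)) * (bj * (T - tj) ^ (2:ℕ)) - (T ^ (2:ℕ) - tj ^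 (2:ℕ)) * (-a * (T - t₀) ^ (2:ℕ))) ^ 2)
          - (bj - bi) * (((T ^ (2:ℕ) - ti ^ (2:ℕ)) * (-a * (T - t₀) ^ (2:ℕ)) - (T ^ (2:ℕ) - t₀ ^ (2:ℕ)) * (bi * (T - ti) ^ (2:ℕ))) / ((T ^ (2:ℕ) - t₀ ^ (2:ℕ)) * (bj * (T - tj) ^ (2:ℕ)) - (T ^ (2:ℕ) - tj ^ (2:ℕ)) * (-a * (T - t₀) ^ (2:ℕ))))
            * ((((2 * T * (bi * (T - ti) ^ (2:ℕ)) + (T ^ (2:ℕ) - tj ^ (2:ℕ)) * (2 * bi * (T - ti))) - (2 * T * (bj * (T - tj) ^ (2:ℕ)) + (T ^ (2:ℕ) - ti ^ (2:ℕ)) * (2 * bj * (T - tj)))) * ((T ^ (2:ℕ) - t₀ ^ (2:ℕ)) * (bj * (T - tj) ^ (2:ℕ)) - (T ^ (2:ℕ) - tj ^ (2:ℕ)) * (-a * (T - t₀) ^ (2:ℕ))) - ((T ^ (2:ℕ) - tj ^ (2:ℕ)) * (bi * (T - ti) ^ (2:ℕ)) - (T ^ (2:ℕ) - ti ^ (2:ℕ))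 * (bj * (T - tj) ^ (2:ℕ))) * ((2 * T * (bj * (T - tj) ^ (2:ℕ)) + (T ^ (2:ℕ) - t₀ ^ (2:ℕ)) * (2 * bj * (T - tj))) - (2 * T * (-a * (T - t₀) ^ (2:ℕ)) + (T ^ (2:ℕ) - tj ^ (2:ℕ)) * (2 * (-a) * (T - t₀))))) / ((T ^ (2:ℕ) - t₀ ^ (2:ℕ)) * (bj * (T - tj) ^ (2:ℕ)) - (T ^ (2:ℕ) - tj ^ (2:ℕ)) * (-a * (T - t₀) ^ (2:ℕ))) ^ 2)
        = (((T ^ (2:ℕ) - tj ^ (2:ℕ)) * (bi * (T - ti) ^ (2:ℕ)) - (T ^ (2:ℕ) - ti ^ (2:ℕ)) * (bj * (T - tj) ^ (2:ℕ))) / ((T ^ (2:ℕ) - t₀ ^ (2:ℕ)) * (bj * (T - tj) ^ (2:ℕ)) - (T ^ (2:ℕ) - tj ^ (2:ℕ)) * (-a * (T - t₀) ^ (2:ℕ)))) * (((T ^ (2:ℕ) - ti ^ (2:ℕ)) * (-a * (T - t₀) ^ (2:ℕ)) - (T ^ (2:ℕ) - t₀ ^ (2:ℕ)) * (bi * (T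 - ti) ^ (2:ℕ))) / ((T ^ (2:ℕ) - t₀ ^ (2:ℕ)) * (bj * (T - tj) ^ (2:ℕ)) - (T ^ (2:ℕ) - tj ^ (2:ℕ)) * (-a * (T - t₀) ^ (2:ℕ))))
          * ((bi - bj) * ((bj * ((T - tj) + (T + ti)) - bi * ((T - ti) + (T + tj))) / (bj * (T + ti) * (T - tj) - bi * (T + tj) * (T - ti)) - 1 / (T - t₀))
      + (a + bj) * ((bj * ((tj - T) - (T + t₀)) - a * ((T - t₀) + (T + tj))) / (bj * (T + t₀) * (tj - T) - a * (T + tj) * (T - t₀)) - 1 / (T - ti))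
      - (a + bi) * ((bi * ((T - ti) + (T + t₀)) + a * ((T - t₀) + (T + ti))) / (bi * (T + t₀) * (T - ti) + a * (T + ti) * (T - t₀)) - 1 / (T - tj)))) ∧
      0 < (((T ^ (2:ℕ) - tj ^ (2:ℕ)) * (bi * (T - ti) ^ (2:ℕ)) - (T ^ (2:ℕ) - ti ^ (2:ℕ)) * (bj * (T - tj) ^ (2:ℕ))) / ((T ^ (2:ℕ) - t₀ ^ (2:ℕ)) * (bj * (T - tj) ^ (2:ℕ)) - (T ^ (2:ℕ) - tj ^ (2:ℕ)) * (-a * (T - t₀) ^ (2:ℕ)))) * (((T ^ (2:ℕ) - ti ^ (2:ℕ)) * (-a * (T - t₀) ^ (2:ℕ)) - (T ^ (2:ℕ) - t₀ ^ (2:ℕ)) * (bi * (T - ti) ^ (2:ℕ))) / ((T ^ (2:ℕ) - t₀ ^ (2:ℕ)) * (bj * (T - tj) ^ (2:ℕ)) - (T ^ (2:ℕ) - tj ^ (2:ℕ)) * (-a * (T - t₀) ^ (2:ℕ)))) := by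
    intro T h1 h2
    have c0 : (bj * (T + ti) * (T - tj) - bi * (T + tj) * (T - ti)) < 0 := q0neg T (by linarith) h2
    have ci : (bj * (T + t₀) * (tj - T) - a * (T + tj) * (T - t₀)) < 0 := qi_neg T h1
    have cj : 0 < (bi * (T + t₀) * (T - ti) + a * (T + ti) * (T - t₀)) := qj_pos T (by linarith)
    refine ⟨foldEndCoeff_eq_logDeriv (ne_of_lt c0) (ne_of_lt ci) (ne_of_gt cj) (ne_of_gt (by linarith)) (ne_of_gt (by linarith))
      (ne_of_lt (by linarith)), ?_⟩
    obtain ⟨eji, e0j, ei0, -, -, -⟩ := minors_eq_neg_cross a bi bj t₀ ti tj T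
    have mji : ((T ^ (2:ℕ) - tj ^ (2:ℕ)) * (bi * (T - ti) ^ (2:ℕ)) - (T ^ (2:ℕ) - ti ^ (2:ℕ)) * (bj * (T - tj) ^ (2:ℕ))) < 0 := by
      rw [eji]; exact neg_neg_of_pos (mul_pos_of_neg_of_neg (mul_neg_of_pos_of_neg (by linarith) (by linarith)) c0)
    have m0j : ((T ^ (2:ℕ) - t₀ ^ (2:ℕ)) * (bj * (T - tj) ^ (2:ℕ)) - (T ^ (2:ℕ) - tj ^ (2:ℕ)) * (-a * (T - t₀) ^ (2:ℕ))) < 0 := by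
      rw [e0j]; exact neg_neg_of_pos (mul_pos_of_neg_of_neg (mul_neg_of_neg_of_pos (by linarith) (by linarith)) ci)
    have mi0 : ((T ^ (2:ℕ) - ti ^ (2:ℕ)) * (-a * (T - t₀) ^ (2:ℕ)) - (T ^ (2:ℕ) - t₀ ^ (2:ℕ)) * (bi * (T - ti) ^ (2:ℕ))) < 0 := by
      rw [ei0]; exact neg_neg_of_pos (mul_pos (mul_pos (by linarith) (by linarith)) cj)
    exact mul_pos (div_pos_of_neg_of_neg mji m0j) (div_pos_of_neg_of_neg mi0 m0j)
  refine ⟨Tm, TR, hTm1, hR1, hR2, hTm0, qi_neg, ?_, ?_, ?_⟩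
  · intro T h1 h2
    obtain ⟨e, hp⟩ := frame T h1 (by linarith)
    rw [e]; exact mul_pos hp (ellR_pos T h1 h2)
  · obtain ⟨e, hp⟩ := frame TR (by linarith) hR2
    rw [e, ellR_zero, mul_zero]
  · intro T h1 h2
    obtain ⟨e, hp⟩ := frame T (by linarith) h2
    rw [e]; exact mul_neg_of_pos_of_neg hp (ellR_neg T h1 h2)

end Summit.ValiantsHypothesis.ValiantsHypothesis.Theorems.LacunarySymmetroidMatrixDescartes.Pivot.CriticalWindows.Four
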